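import Literature.Computability.Complexity.RandomizingPolynomialsHessenberg
import HarnessLib

/-!
# Route SzkEntropy, crux `PeaWorstToAvg` (stmt-PneNP-10777), line `dual-mode-compile`: stub `stub_canon`

Support file for the line `dual-mode-compile` on the crux `SzkEntropy.PeaWorstToAvg`.  It closes the
registered stub `stub_canon` — the general Ishai–Kushilevitz CANONICAL FORM of a unit-lower-Hessenberg
matrix over `F₂` (`A * L * B = RandPoly.canon L.det` with `A` upper unitriangular and `B` a
last-column matrix) — as a corollary of the Literature theorem `RandPoly.exists_canon_of_hessenberg`
(`RandomizingPolynomialsHessenberg.lean`: `U := [e₀ | columns 0 … d-1 of L]` is upper unitriangular,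
`A := U⁻¹`, one last-column matrix clears the last column, `det (canon δ) = δ`).  The sibling stub
`stub_blockPerf` consumes this statement verbatim as its hypothesis `hcanon`.

References: Y. Ishai, E. Kushilevitz, *Perfect constant-round secure computation via perfect
randomizing polynomials*, ICALP 2002, §3, Lemma 1; B. Applebaum, Y. Ishai, E. Kushilevitz,
*Cryptography in NC⁰*, SIAM J. Comput. 36 (2006), §4.2, Fact 4.6.
-/

namespace Summit.PneNP.PneNP.Cruxes.PeaWorstToAvg.DualModeCompile

set_option linter.dupNamespace false -- `Summit.PneNP.PneNP.…`: summit = sub-problem name (D-0017)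

open Literature.Computability.Complexity

/-- **STUB `stub_canon` of the line `dual-mode-compile` — the Ishai–Kushilevitz canonical form.**
For every unit-lower-Hessenberg matrix `L` over `F₂` (subdiagonal `1`, zero below it, arbitrary on
and above the diagonal) there are an upper unitriangular `A` and a last-column matrix `B` with
`A * L * B = canon (det L)` (Literature: `RandPoly.exists_canon_of_hessenberg`).
[IshaiKushilevitz2002, §3, Lemma 1; ApplebaumIshaiKushilevitz2006, §4.2, Fact 4.6] -/
theorem stub_canon :
    ∀ (d : ℕ) (L : RandPoly.Mat d),
      (∀ i j : Fin (d + 1), i.val = j.val + 1 → L i j = 1) →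
      (∀ i j : Fin (d + 1), j.val + 1 < i.val → L i j = 0) →
      ∃ A B : RandPoly.Mat d, RandPoly.IsUnitri A ∧ RandPoly.IsLastCol B ∧ A * L * B = RandPoly.canon L.det :=
  fun _ L h1 h0 => RandPoly.exists_canon_of_hessenberg L h1 h0

end Summit.PneNP.PneNP.Cruxes.PeaWorstToAvg.DualModeCompile
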